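import Summits.QuantumFields.YangMills.Theorems.BalabanUVNodesN11Sect3SupplyChainBorelBObligationsOfSolvable
import Summits.QuantumFields.YangMills.Theorems.BalabanUVNodesN11Sect3SupplyChainBorelBThm1Printed

/-!
# DAG node N11 — BOREL 𝐁-TERMS ALONG THE WITNESS CHAIN, V: N11's PRINTED OUTPUT `B16.Thm1Printed` on the `SupplierBorel` road WITHOUT reading-line primitives — at a
# Gaussian-class parameter with the separated-range key, at the K1⁷-keyed datum, and at the NAMED certificate `gaussPinH θ` (no class hypothesis)

HEADER — WORK-UNIT METADATA.  Cell `pub-ymgap`, YM-PLAN Track A (D-0062 ∕ D-0149 width seats), seat `pub-ymgap-dag-n11-w1` (g2; WIDTH SEAT 1 of 4 on NODE n11 [B14]),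
route `BalabanUVNodes` rev 25, item K1⁷ `StabilityBAtRecordR13SepCoPH` = stmt-QuantumFields-20542 (helper, `--kind proof --supports 20542 --as helper`, count-neutral).
[III] = [Balaban1988Convergent], [15] = [Balaban1985Variational], [B7] = [Balaban1985Averaging], [B16] = [Balaban1989LargeFieldII].  Over this seat's
`…N11Sect3SupplyChainBorelBObligationsOfSolvable` (§3 `noExpansionObligation_of_gaussCert_of_supplierBorel_of_solvable`: the chain's no-expansion obligation at a Gaussian certificate
from `SupplierBorel`, K0's rows and the run's structure — NO `RegOn`, NO `BgProvisoΛ`), g0's `…BorelBThm1Printed` (`step_inInterval_of_flow_inInterval_min`) ∕ `…GaussianCertificateDefs`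
(`gaussPinH`, `gaussPinH_ζ0`, `gaussPinH_quad`), dag-n11-e's `…N11Sect3SupplyChainNode.thm1Printed_datumOfRecord₁₃CoPH_of_obligations` (Theorem 1 printed from a supplier per windowed
run; def-T's `thm1Printed_datumOfRecord₁₃CoPH_of_tLaw_rOpLeaf` with the 𝐑-leaf closed on the live line).

WHAT THIS FILE PROVES (8 theorems, 0 `sorry`, 0 `def`; nothing of Bałaban asserted).
§4 `provisos₁₃SepCoPH_gaussPinH` (the separated-range key transfers to the certificate — first component of g0's `antecedent_gaussPinH`, no `hnd` ∕ `hadm`); ★★★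
   `noExpansionObligation_gaussPinH_of_supplierBorel_of_solvable` ∕ ★★★ `supplyChainAt_gaussPinH_of_supplierBorel_of_solvable` ∕ ★★★★
   `sLaw₁₃CoPH_all_gaussPinH_of_obligations_of_supplierBorel_of_solvable` — the previous file's §3 at the NAMED certificate `gaussPinH θ`, NO class hypothesis.
§5 ★ `step_inInterval_top_of_flow_inInterval_min` (the full-length window read off the datum; g0's lemma stopped at `k < K`); ★★★★
   `thm1Printed_datumOfRecord₁₃CoPH_of_gaussCert_of_supplierBorel_of_solvable` ∕ ★★★★ `thm1Printed_datumOfRecord₁₃SepCoPH_of_gaussCert_of_supplierBorel_of_solvable` (K1⁷-keyed datum,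
   `rfl`) ∕ ★★★★★ `thm1Printed_datumOfRecord₁₃SepCoPH_gaussPinH_of_supplierBorel_of_solvable` — g0 p603200 §2∕§4 RE-KEYED: N11's PRINTED OUTPUT from the key, the live-selector line,
   the letters `0 < M₁ ≤ M`, `2 ≤ cR`, and PER RUN IN A WINDOW `]0, γ]`: `PartCompat₁₃` up to `K`, K0's per-cube [15]-solvability + cube cover + numerics at levels `1…K`, and
   [III] §3's supplier with `SupplierObligations` + `SupplierBorel`.  NO `RegOn`, NO `BgProvisoΛ`, NO operand row, NO term bound, NO (K0b) row, NO residual row, NO `T`-family.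

HONEST FRAMING.  Helper lane of K1⁷; kernel composition; nothing of [III] ∕ [15] ∕ [B7] ∕ [B16] asserted — per-cube solvability, the cube cover, the numerics, `PartCompat₁₃`,
`Provisos₁₃SepCoPH` and the supplier are HYPOTHESES (K0 ∕ def-R ∕ plan ∕ [III] §3 rows).  NO edition at the witness of record `theta13LiveOfRecord` is offered (`cR = 1`,
`M = M₂ = 1`: `2 ≤ cR` and the cover are UNINHABITED there — dag-n11-d LOCATED g12); the faces serve the all-numerics families where `cR`, `M`, `M₂` are letters.  N11 NOT
discharged (the displayed rows ARE [III] §3 + K0's analysis); K1⁷ NOT closed; counts unmoved (typed 28∕28 · discharged 5∕27).  R4 closes only the conditional finite-𝕋⁴ rung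
`BalabanLadder.UV` of one programme at fixed `ε = L^{−K}` — NOT ℝ⁴, NOT OS, NOT a mass gap, NOT Clay.  No `sorry`, `axiom`, `def`, `instance`, `notation`.
Sources (SHAPE only): [III] Thm 1 p.262, Theorem p.245, §3 p.279, (3.24)–(3.25) p.270, (0.2) p.244; [B16] Thm 1 p.355; [Balaban1987RG1] Thm 1 p.259 (the window `]0, γ]`);
[Balaban1989LargeFieldI] (0.3)–(0.4) p.176, p.177 (i)–(ii); [15] Thm 1 (7)–(8) pp.278–279; [B7] Prop. 2 p.26.
-/

noncomputable section

open MeasureTheory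
open scoped BigOperators ENNReal NNReal Matrix.Norms.L2Operator

namespace Summit.QuantumFields.YangMills.Theorems.BalabanUVNodesN11Sect3SupplyChainBorelBThm1PrintedOfSolvable

open Literature.MathematicalPhysics.QuantumFieldTheory.Balaban1983to89 T4Continuum T4NestedCovariance Node00 Node00.Tk DagBinding
open B15DeterminingSets B8Eq17ClassAkV1 B14.Eq218Concrete B10Eq42TorusConstraint Step
open B14.Eq213MaximalDomains (side)
open B14.Eq213DetSet (Bj)
open Literature.MathematicalPhysics.QuantumFieldTheory.BalabanImbrieJaffe1984to88.BIJ85Eq453GaugeField (qsstarGIter0)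
open BalabanUVNodesN11HistoryPinnedResidualDefs BalabanUVNodesN11RePinnedParamDefs
open BalabanUVNodesN11GaussianCertificateRows
open BalabanUVNodesN11GaussianCertificateDefs (gaussPinH gaussPinH_ζ0 gaussPinH_quad provisos₁₃CoPH_gaussPinH)
open BalabanUVNodesN11Sect3SupplyChainDefs
open BalabanUVNodesN11Sect3SupplyChainBorelB
open BalabanUVNodesN11Sect3SupplyChainObligationsDefs
open BalabanUVNodesN11Sect3SupplyChainNode (thm1Printed_datumOfRecord₁₃CoPH_of_obligations)
open BalabanUVNodesN11Sect3SupplyChainBorelBObligationsOfSolvable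

variable {F : T4Family} {N : ℕ} [NeZero N]

/-! ## §4  At the NAMED Gaussian certificate `gaussPinH θ` — no class hypothesis -/

section Named

variable {θ : Stage13HParams F N}

/-- **THE SEPARATED-RANGE KEY TRANSFERS TO THE GAUSSIAN CERTIFICATE** (`gaussPinH θ` shares `θ.toStage13Params`; its history-indexed residual `ζ0` is the certificate's, with
print's laws by dag-n11-d's `laws_ZhPinOfRecord₁₃` ∕ `localLaws_ZhPinOfRecord₁₃`) — the first component of g0's `antecedent_gaussPinH`, without `hnd` ∕ `hadm`.
[cite: Balaban1988Convergent, (2.18) p.257, (2.21) p.258, (2.28) p.259, (3.16) p.268 (bookkeeping)] -/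
theorem provisos₁₃SepCoPH_gaussPinH (h : θ.Provisos₁₃SepCoPH F N) : (gaussPinH θ).Provisos₁₃SepCoPH F N where
  intPiece := h.intPiece
  measω := h.measω
  measChi := h.measChi
  zetaUnity := h.zetaUnity
  zetaAbs := h.zetaAbs
  rstep := fun p k _ hk => h.rstep p k hk
  rzLaws := h.rzLaws
  zhLaws := fun p _ Ω Λ =>
    ⟨(BalabanUVNodesN11HistoryPinnedResidualDefs.laws_ZhPinOfRecord₁₃ (θ := θ.toStage13Params) (p := p) h.zetaUnity Ω Λ).zeta0_nonneg⟩
  zhLocal := fun p _ Ω Λ =>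
    ⟨(BalabanUVNodesN11HistoryPinnedResidualDefs.localLaws_ZhPinOfRecord₁₃ (θ := θ.toStage13Params) (p := p) Ω Λ).zeta0_local⟩
  hM := h.hM
  hM₁ := h.hM₁
  bg := h.bg

variable (θ) (p : B12.RunParams)

/-- **★★★ `NoExpansionObligation (gaussPinH θ) p σ` AT THE NAMED GAUSSIAN CERTIFICATE — NO CLASS HYPOTHESIS, NO READING-LINE PRIMITIVE**: §3 at `gaussPinH θ` (`gaussPinH_ζ0` ∕
`gaussPinH_quad` are `rfl`, the key transfers by `provisos₁₃SepCoPH_gaussPinH`); hypotheses in `θ`'s vocabulary (the certificate shares `θ.toStage13Params`).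
[cite: Balaban1988Convergent, Theorem p.245, Thm 1 p.262, §3 p.279, (3.24)–(3.25) p.270, (2.27)–(2.28) p.259; Balaban1985Variational, Thm 1 (7)–(8) pp.278–279] -/
theorem noExpansionObligation_gaussPinH_of_supplierBorel_of_solvable (h : θ.Provisos₁₃SepCoPH F N) (hθ : θ.Admissible F N)
    (hM₁ : 0 < θ.ν.M₁) (hle : θ.ν.M₁ ≤ θ.τ9.M) (hcR : 2 ≤ θ.s2.cR)
    (hw : Step.InInterval θ.toStage13Params.γ p.K (gOfRecord₁₃ F N θ.toStage13Params p)) (hPC : PartCompat₁₃ F N θ.toStage13Params p p.K)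
    (h3 : ∀ j, 1 ≤ j → j ≤ p.K →
      3 * side (F.P p.K).L θ.toStage13Params.ν.M₁ j ≤ cubeSide (F.P p.K).L θ.toStage13Params.ν.M₂ (RkOfRecord (F.P p.K).L θ.toStage13Params.ν.r (gOfRecord₁₃ F N θ.toStage13Params p j)) j)
    (hR : ∀ j, 1 ≤ j → j ≤ p.K → (F.P p.K).L ^ j + (((F.P p.K).d + 4) * (F.P p.K).L + 2) * (∑ l ∈ Finset.range j, (F.P p.K).L ^ l) + 2 ≤
      cubeSide (F.P p.K).L θ.toStage13Params.ν.M₂ (RkOfRecord (F.P p.K).L θ.toStage13Params.ν.r (gOfRecord₁₃ F N θ.toStage13Params p j)) j)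
    (hε : ∀ j, 1 ≤ j → j ≤ p.K → 0 < epsOfRecord θ.toStage13Params.ν (gOfRecord₁₃ F N θ.toStage13Params p) j)
    (hε3 : ∀ j, 1 ≤ j → j ≤ p.K → (143 * (((((F.P p.K).d + 4 : ℕ) : ℝ)) ^ 2 / 4) ^ 2) * epsOfRecord θ.toStage13Params.ν (gOfRecord₁₃ F N θ.toStage13Params p) j ≤ 1 / 3)
    (hε2 : ∀ j, 1 ≤ j → j ≤ p.K →
      2 * epsOfRecord θ.toStage13Params.ν (gOfRecord₁₃ F N θ.toStage13Params p) j ≤ 2 * ExpMeanLog.deltaSU (Fin N) / ((((F.P p.K).d + 4) * (F.P p.K).L : ℕ) : ℝ) ^ 2)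
    (hsolv : ∀ j, 1 ≤ j → j ≤ p.K → ∀ (s : SeqOfRecord F θ.toStage13Params.ν θ.toStage13Params.τ9.M (gOfRecord₁₃ F N θ.toStage13Params p) p.K j) (V : GaugeField (F.P p.K) j (SU N)),
      chiSeqOfRecord F N θ.toStage13Params.ν θ.toStage13Params.τ9.M (gOfRecord₁₃ F N θ.toStage13Params p) p.K j s V ≠ 0 →
      ∀ a ∈ cubesIn (fun a : ↥(cubeIndices (F.P p.K) (cubeSide (F.P p.K).L θ.toStage13Params.ν.M₂ (RkOfRecord (F.P p.K).L θ.toStage13Params.ν.r (gOfRecord₁₃ F N θ.toStage13Params p j)) j)) =>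
          cubeEnl (F.P p.K) (cubeSide (F.P p.K).L θ.toStage13Params.ν.M₂ (RkOfRecord (F.P p.K).L θ.toStage13Params.ν.r (gOfRecord₁₃ F N θ.toStage13Params p j)) j) a 0) (s.Ω j),
        ∃ U₀, IsMinimizer (avOfRecord F N p.K) {U | PlaqSmall (θ.toStage13Params.ν.εreg * (F.P p.K).eta j ^ 2) U}
          (Bj θ.toStage13Params.ν.M₁ (cubeEnl (F.P p.K) (cubeSide (F.P p.K).L θ.toStage13Params.ν.M₂ (RkOfRecord (F.P p.K).L θ.toStage13Params.ν.r (gOfRecord₁₃ F N θ.toStage13Params p j)) j) a 4) j)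
          (avgFamily (avOfRecord F N p.K) (qsstarGIter0 j V)) U₀)
    (hcov : ∀ j, 1 ≤ j → j ≤ p.K → ∀ s : SeqOfRecord F θ.toStage13Params.ν θ.toStage13Params.τ9.M (gOfRecord₁₃ F N θ.toStage13Params p) p.K j,
      s.Ω j ⊆ ⋃ a ∈ cubesIn (fun a : ↥(cubeIndices (F.P p.K) (cubeSide (F.P p.K).L θ.toStage13Params.ν.M₂ (RkOfRecord (F.P p.K).L θ.toStage13Params.ν.r (gOfRecord₁₃ F N θ.toStage13Params p j)) j)) =>
          cubeEnl (F.P p.K) (cubeSide (F.P p.K).L θ.toStage13Params.ν.M₂ (RkOfRecord (F.P p.K).L θ.toStage13Params.ν.r (gOfRecord₁₃ F N θ.toStage13Params p j)) j) a 0) (s.Ω j),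
        cubeEnl (F.P p.K) (cubeSide (F.P p.K).L θ.toStage13Params.ν.M₂ (RkOfRecord (F.P p.K).L θ.toStage13Params.ν.r (gOfRecord₁₃ F N θ.toStage13Params p j)) j) a 0)
    (σ : Sect3Supplier (gaussPinH θ) p) (hσB : SupplierBorel (gaussPinH θ) p σ) :
    NoExpansionObligation (gaussPinH θ) p σ :=
  noExpansionObligation_of_gaussCert_of_supplierBorel_of_solvable (gaussPinH θ) p (gaussPinH_ζ0 θ) (gaussPinH_quad θ) (provisos₁₃SepCoPH_gaussPinH h) hθ hM₁ hle hcR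
    hw hPC h3 hR hε hε3 hε2 hsolv hcov σ hσB

/-- **★★★ N11's ONE-TOKEN RESIDUAL `SupplyChainAt (gaussPinH θ) p` AT THE NAMED CERTIFICATE** from a supplier with `SupplierObligations` + `SupplierBorel`, K0's rows and the
run's structure — NO class hypothesis, NO reading-line primitive. [cite: Balaban1988Convergent, Thm 1 p.262, Theorem p.245, §3 p.279, (3.24)–(3.25) p.270] -/
theorem supplyChainAt_gaussPinH_of_supplierBorel_of_solvable (h : θ.Provisos₁₃SepCoPH F N) (hθ : θ.Admissible F N)
    (hM₁ : 0 < θ.ν.M₁) (hle : θ.ν.M₁ ≤ θ.τ9.M) (hcR : 2 ≤ θ.s2.cR)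
    (hw : Step.InInterval θ.toStage13Params.γ p.K (gOfRecord₁₃ F N θ.toStage13Params p)) (hPC : PartCompat₁₃ F N θ.toStage13Params p p.K)
    (h3 : ∀ j, 1 ≤ j → j ≤ p.K →
      3 * side (F.P p.K).L θ.toStage13Params.ν.M₁ j ≤ cubeSide (F.P p.K).L θ.toStage13Params.ν.M₂ (RkOfRecord (F.P p.K).L θ.toStage13Params.ν.r (gOfRecord₁₃ F N θ.toStage13Params p j)) j)
    (hR : ∀ j, 1 ≤ j → j ≤ p.K → (F.P p.K).L ^ j + (((F.P p.K).d + 4) * (F.P p.K).L + 2) * (∑ l ∈ Finset.range j, (F.P p.K).L ^ l) + 2 ≤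
      cubeSide (F.P p.K).L θ.toStage13Params.ν.M₂ (RkOfRecord (F.P p.K).L θ.toStage13Params.ν.r (gOfRecord₁₃ F N θ.toStage13Params p j)) j)
    (hε : ∀ j, 1 ≤ j → j ≤ p.K → 0 < epsOfRecord θ.toStage13Params.ν (gOfRecord₁₃ F N θ.toStage13Params p) j)
    (hε3 : ∀ j, 1 ≤ j → j ≤ p.K → (143 * (((((F.P p.K).d + 4 : ℕ) : ℝ)) ^ 2 / 4) ^ 2) * epsOfRecord θ.toStage13Params.ν (gOfRecord₁₃ F N θ.toStage13Params p) j ≤ 1 / 3)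
    (hε2 : ∀ j, 1 ≤ j → j ≤ p.K →
      2 * epsOfRecord θ.toStage13Params.ν (gOfRecord₁₃ F N θ.toStage13Params p) j ≤ 2 * ExpMeanLog.deltaSU (Fin N) / ((((F.P p.K).d + 4) * (F.P p.K).L : ℕ) : ℝ) ^ 2)
    (hsolv : ∀ j, 1 ≤ j → j ≤ p.K → ∀ (s : SeqOfRecord F θ.toStage13Params.ν θ.toStage13Params.τ9.M (gOfRecord₁₃ F N θ.toStage13Params p) p.K j) (V : GaugeField (F.P p.K) j (SU N)),
      chiSeqOfRecord F N θ.toStage13Params.ν θ.toStage13Params.τ9.M (gOfRecord₁₃ F N θ.toStage13Params p) p.K j s V ≠ 0 →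
      ∀ a ∈ cubesIn (fun a : ↥(cubeIndices (F.P p.K) (cubeSide (F.P p.K).L θ.toStage13Params.ν.M₂ (RkOfRecord (F.P p.K).L θ.toStage13Params.ν.r (gOfRecord₁₃ F N θ.toStage13Params p j)) j)) =>
          cubeEnl (F.P p.K) (cubeSide (F.P p.K).L θ.toStage13Params.ν.M₂ (RkOfRecord (F.P p.K).L θ.toStage13Params.ν.r (gOfRecord₁₃ F N θ.toStage13Params p j)) j) a 0) (s.Ω j),
        ∃ U₀, IsMinimizer (avOfRecord F N p.K) {U | PlaqSmall (θ.toStage13Params.ν.εreg * (F.P p.K).eta j ^ 2) U}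
          (Bj θ.toStage13Params.ν.M₁ (cubeEnl (F.P p.K) (cubeSide (F.P p.K).L θ.toStage13Params.ν.M₂ (RkOfRecord (F.P p.K).L θ.toStage13Params.ν.r (gOfRecord₁₃ F N θ.toStage13Params p j)) j) a 4) j)
          (avgFamily (avOfRecord F N p.K) (qsstarGIter0 j V)) U₀)
    (hcov : ∀ j, 1 ≤ j → j ≤ p.K → ∀ s : SeqOfRecord F θ.toStage13Params.ν θ.toStage13Params.τ9.M (gOfRecord₁₃ F N θ.toStage13Params p) p.K j,
      s.Ω j ⊆ ⋃ a ∈ cubesIn (fun a : ↥(cubeIndices (F.P p.K) (cubeSide (F.P p.K).L θ.toStage13Params.ν.M₂ (RkOfRecord (F.P p.K).L θ.toStage13Params.ν.r (gOfRecord₁₃ F N θ.toStage13Params p j)) j)) =>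
          cubeEnl (F.P p.K) (cubeSide (F.P p.K).L θ.toStage13Params.ν.M₂ (RkOfRecord (F.P p.K).L θ.toStage13Params.ν.r (gOfRecord₁₃ F N θ.toStage13Params p j)) j) a 0) (s.Ω j),
        cubeEnl (F.P p.K) (cubeSide (F.P p.K).L θ.toStage13Params.ν.M₂ (RkOfRecord (F.P p.K).L θ.toStage13Params.ν.r (gOfRecord₁₃ F N θ.toStage13Params p j)) j) a 0)
    (σ : Sect3Supplier (gaussPinH θ) p) (hσ : SupplierObligations (gaussPinH θ) p σ) (hσB : SupplierBorel (gaussPinH θ) p σ) :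
    SupplyChainAt (gaussPinH θ) p :=
  ⟨σ, hσ, noExpansionObligation_gaussPinH_of_supplierBorel_of_solvable θ p h hθ hM₁ hle hcR hw hPC h3 hR hε hε3 hε2 hsolv hcov σ hσB⟩

/-- **★★★★ THEOREM 1 OF [III] ALONG THE CHAIN AT THE NAMED GAUSSIAN CERTIFICATE `gaussPinH θ` — `∀ k ≤ K, SLaw₁₃CoPH (gaussPinH θ) p k` — FROM `SupplierObligations`,
`SupplierBorel`, K0's ROWS AND THE RUN's STRUCTURE; NO CLASS HYPOTHESIS, NO READING-LINE PRIMITIVE** (§3's THEOREM 1 at the named witness; live-selector line of `θ`).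
[cite: Balaban1988Convergent, Thm 1 p.262, Theorem p.245, §3 p.279, (3.24)–(3.25) p.270; Balaban1989LargeFieldI, (0.2)–(0.4) p.176, p.177 (i)–(ii)] -/
theorem sLaw₁₃CoPH_all_gaussPinH_of_obligations_of_supplierBorel_of_solvable (h : θ.Provisos₁₃SepCoPH F N)
    (hsel : θ.ppSel = ppSelLiveOfRecord F N θ.ν θ.τ9 (EOfRecord₁₃ F N θ.toStage13Params) (wOfRecord₉ F N θ.toStage9Params))
    (hθ : θ.Admissible F N) (hκ : 0 ≤ θ.s2.lf.κ) (hE₀ : 0 ≤ θ.s2.lf.E₀) (hB₀ : 0 ≤ θ.s2.lf.B₀)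
    (hM₁ : 0 < θ.ν.M₁) (hle : θ.ν.M₁ ≤ θ.τ9.M) (hcR : 2 ≤ θ.s2.cR)
    (hw : Step.InInterval θ.toStage13Params.γ p.K (gOfRecord₁₃ F N θ.toStage13Params p)) (hPC : PartCompat₁₃ F N θ.toStage13Params p p.K)
    (h3 : ∀ j, 1 ≤ j → j ≤ p.K →
      3 * side (F.P p.K).L θ.toStage13Params.ν.M₁ j ≤ cubeSide (F.P p.K).L θ.toStage13Params.ν.M₂ (RkOfRecord (F.P p.K).L θ.toStage13Params.ν.r (gOfRecord₁₃ F N θ.toStage13Params p j)) j)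
    (hR : ∀ j, 1 ≤ j → j ≤ p.K → (F.P p.K).L ^ j + (((F.P p.K).d + 4) * (F.P p.K).L + 2) * (∑ l ∈ Finset.range j, (F.P p.K).L ^ l) + 2 ≤
      cubeSide (F.P p.K).L θ.toStage13Params.ν.M₂ (RkOfRecord (F.P p.K).L θ.toStage13Params.ν.r (gOfRecord₁₃ F N θ.toStage13Params p j)) j)
    (hε : ∀ j, 1 ≤ j → j ≤ p.K → 0 < epsOfRecord θ.toStage13Params.ν (gOfRecord₁₃ F N θ.toStage13Params p) j)
    (hε3 : ∀ j, 1 ≤ j → j ≤ p.K → (143 * (((((F.P p.K).d + 4 : ℕ) : ℝ)) ^ 2 / 4) ^ 2) * epsOfRecord θ.toStage13Params.ν (gOfRecord₁₃ F N θ.toStage13Params p) j ≤ 1 / 3)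
    (hε2 : ∀ j, 1 ≤ j → j ≤ p.K →
      2 * epsOfRecord θ.toStage13Params.ν (gOfRecord₁₃ F N θ.toStage13Params p) j ≤ 2 * ExpMeanLog.deltaSU (Fin N) / ((((F.P p.K).d + 4) * (F.P p.K).L : ℕ) : ℝ) ^ 2)
    (hsolv : ∀ j, 1 ≤ j → j ≤ p.K → ∀ (s : SeqOfRecord F θ.toStage13Params.ν θ.toStage13Params.τ9.M (gOfRecord₁₃ F N θ.toStage13Params p) p.K j) (V : GaugeField (F.P p.K) j (SU N)),
      chiSeqOfRecord F N θ.toStage13Params.ν θ.toStage13Params.τ9.M (gOfRecord₁₃ F N θ.toStage13Params p) p.K j s V ≠ 0 →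
      ∀ a ∈ cubesIn (fun a : ↥(cubeIndices (F.P p.K) (cubeSide (F.P p.K).L θ.toStage13Params.ν.M₂ (RkOfRecord (F.P p.K).L θ.toStage13Params.ν.r (gOfRecord₁₃ F N θ.toStage13Params p j)) j)) =>
          cubeEnl (F.P p.K) (cubeSide (F.P p.K).L θ.toStage13Params.ν.M₂ (RkOfRecord (F.P p.K).L θ.toStage13Params.ν.r (gOfRecord₁₃ F N θ.toStage13Params p j)) j) a 0) (s.Ω j),
        ∃ U₀, IsMinimizer (avOfRecord F N p.K) {U | PlaqSmall (θ.toStage13Params.ν.εreg * (F.P p.K).eta j ^ 2) U}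
          (Bj θ.toStage13Params.ν.M₁ (cubeEnl (F.P p.K) (cubeSide (F.P p.K).L θ.toStage13Params.ν.M₂ (RkOfRecord (F.P p.K).L θ.toStage13Params.ν.r (gOfRecord₁₃ F N θ.toStage13Params p j)) j) a 4) j)
          (avgFamily (avOfRecord F N p.K) (qsstarGIter0 j V)) U₀)
    (hcov : ∀ j, 1 ≤ j → j ≤ p.K → ∀ s : SeqOfRecord F θ.toStage13Params.ν θ.toStage13Params.τ9.M (gOfRecord₁₃ F N θ.toStage13Params p) p.K j,
      s.Ω j ⊆ ⋃ a ∈ cubesIn (fun a : ↥(cubeIndices (F.P p.K) (cubeSide (F.P p.K).L θ.toStage13Params.ν.M₂ (RkOfRecord (F.P p.K).L θ.toStage13Params.ν.r (gOfRecord₁₃ F N θ.toStage13Params p j)) j)) =>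
          cubeEnl (F.P p.K) (cubeSide (F.P p.K).L θ.toStage13Params.ν.M₂ (RkOfRecord (F.P p.K).L θ.toStage13Params.ν.r (gOfRecord₁₃ F N θ.toStage13Params p j)) j) a 0) (s.Ω j),
        cubeEnl (F.P p.K) (cubeSide (F.P p.K).L θ.toStage13Params.ν.M₂ (RkOfRecord (F.P p.K).L θ.toStage13Params.ν.r (gOfRecord₁₃ F N θ.toStage13Params p j)) j) a 0)
    (σ : Sect3Supplier (gaussPinH θ) p) (hσ : SupplierObligations (gaussPinH θ) p σ) (hσB : SupplierBorel (gaussPinH θ) p σ) :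
    ∀ k, k ≤ p.K → SLaw₁₃CoPH F N (gaussPinH θ) p k :=
  sLaw₁₃CoPH_all_of_obligations_of_gaussCert_of_supplierBorel_of_solvable (gaussPinH θ) p (gaussPinH_ζ0 θ) (gaussPinH_quad θ) (provisos₁₃SepCoPH_gaussPinH h)
    hsel hθ hκ hE₀ hB₀ hM₁ hle hcR hw hPC h3 hR hε hε3 hε2 hsolv hcov σ hσ hσB

end Named

/-! ## §5  N11's PRINTED OUTPUT `B16.Thm1Printed` on the `SupplierBorel` road WITHOUT reading-line primitives -/

section Printed

variable (θ : Stage13HParams F N)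

/-- **★ THE FULL-LENGTH STEP WINDOW READ OFF THE DATUM**: a run in the datum's window `]0, min γ Γ]` is a `K`-run in B12's step windows `]0, γ]` AND `]0, Γ]` (`flow.g` is
`gOfRecord₁₃`, `rfl`) — g0's `step_inInterval_of_flow_inInterval_min` at the top length `K` (every shorter window follows; the child-level window at `k + 1 = K` is needed).
[cite: Balaban1987RG1, Thm 1 p.259; Balaban1988Convergent, (2.10) p.256 (bookkeeping)] -/
theorem step_inInterval_top_of_flow_inInterval_min (h : θ.Provisos₁₃CoPH F N) {γ Γ : ℝ} {P : B12.RunParams}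
    (hP : ((datumOfRecord₁₃CoPH F N θ h).C P).flow.InInterval (min γ Γ) P.K) :
    Step.InInterval γ P.K (gOfRecord₁₃ F N θ.toStage13Params P) ∧ Step.InInterval Γ P.K (gOfRecord₁₃ F N θ.toStage13Params P) :=
  ⟨fun j hj => ⟨(hP j hj).1, (hP j hj).2.trans (min_le_left _ _)⟩, fun j hj => ⟨(hP j hj).1, (hP j hj).2.trans (min_le_right _ _)⟩⟩

/-- **★★★★ N11's PRINTED OUTPUT `B16.Thm1Printed (datumOfRecord₁₃CoPH F N θ h.toCore).C` AT ANY GAUSSIAN-CLASS `θ` WITH THE SEPARATED-RANGE KEY, ON THE LIVE-SELECTOR LINE,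
FROM — PER RUN IN ANY WINDOW `]0, γ]`, `0 < γ` — `PartCompat₁₃` UP TO `K`, K0's ROWS AT LEVELS `1…K`, AND [III] §3's SUPPLIER WITH `SupplierObligations` + `SupplierBorel`**
(g0 p603200 §2 RE-KEYED): dag-n11-e's `thm1Printed_datumOfRecord₁₃CoPH_of_obligations` with its `NoExpansionObligation` DISCHARGED run by run by §3, the full-length step window read off
the datum (`step_inInterval_top_of_flow_inInterval_min`) in the printed window `]0, min γ θ.γ]` (`0 < θ.γ` from admissibility); θ-level letters `0 < M₁ ≤ M`, `2 ≤ cR`.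
NO `RegOn`, NO `BgProvisoΛ`, NO operand row, NO term bound, NO (K0b) row, NO residual row, NO `T`-family, NO `γ ≤ θ.γ`.
[cite: Balaban1988Convergent, Thm 1 p.262, Theorem p.245, §3 p.279, (3.24)–(3.25) p.270; Balaban1989LargeFieldII, Thm 1 p.355; Balaban1989LargeFieldI, (0.3)–(0.4) p.176, p.177 (i)–(ii); Balaban1985Variational, Thm 1 (7)–(8) pp.278–279] -/
theorem thm1Printed_datumOfRecord₁₃CoPH_of_gaussCert_of_supplierBorel_of_solvable
    (hζ : ∀ (p : B12.RunParams) (n : ℕ) (Ω Λ : ℕ → Set (Site (F.P p.K) 0)), (θ.Zh p n Ω Λ).ζ0 = (ZhPinOfRecord₁₃ θ.toStage13Params p Ω Λ).ζ0)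
    (hq : ∀ (p : B12.RunParams) (n : ℕ) (Ω Λ : ℕ → Set (Site (F.P p.K) 0)) (j : ℕ) (Λ' : Set (Site (F.P p.K) 0)) (ω : MultiCfg (F.P p.K) (SU N) (FluctV N)),
      (θ.Zh p n Ω Λ).quad j Λ' ω = ∑ b ∈ (Set.toFinite (bondsIn j (Λ'ᶜ ∩ Ω (j + 1)))).toFinset, ‖(ω j).2 b‖ ^ 2)
    (h : θ.Provisos₁₃SepCoPH F N) (hsel : θ.ppSel = ppSelLiveOfRecord F N θ.ν θ.τ9 (EOfRecord₁₃ F N θ.toStage13Params) (wOfRecord₉ F N θ.toStage9Params))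
    (hθ : θ.Admissible F N) (hκ : 0 ≤ θ.s2.lf.κ) (hE₀ : 0 ≤ θ.s2.lf.E₀) (hB₀ : 0 ≤ θ.s2.lf.B₀)
    (hM₁ : 0 < θ.ν.M₁) (hle : θ.ν.M₁ ≤ θ.τ9.M) (hcR : 2 ≤ θ.s2.cR) {γ : ℝ} (hγ : 0 < γ)
    (hPC : ∀ P : B12.RunParams, Step.InInterval γ P.K (gOfRecord₁₃ F N θ.toStage13Params P) → PartCompat₁₃ F N θ.toStage13Params P P.K)
    (h3 : ∀ P : B12.RunParams, Step.InInterval γ P.K (gOfRecord₁₃ F N θ.toStage13Params P) → ∀ j, 1 ≤ j → j ≤ P.K →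
      3 * side (F.P P.K).L θ.ν.M₁ j ≤ cubeSide (F.P P.K).L θ.ν.M₂ (RkOfRecord (F.P P.K).L θ.ν.r (gOfRecord₁₃ F N θ.toStage13Params P j)) j)
    (hR : ∀ P : B12.RunParams, Step.InInterval γ P.K (gOfRecord₁₃ F N θ.toStage13Params P) → ∀ j, 1 ≤ j → j ≤ P.K →
      (F.P P.K).L ^ j + (((F.P P.K).d + 4) * (F.P P.K).L + 2) * (∑ l ∈ Finset.range j, (F.P P.K).L ^ l) + 2 ≤
        cubeSide (F.P P.K).L θ.ν.M₂ (RkOfRecord (F.P P.K).L θ.ν.r (gOfRecord₁₃ F N θ.toStage13Params P j)) j)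
    (hε : ∀ P : B12.RunParams, Step.InInterval γ P.K (gOfRecord₁₃ F N θ.toStage13Params P) → ∀ j, 1 ≤ j → j ≤ P.K →
      0 < epsOfRecord θ.ν (gOfRecord₁₃ F N θ.toStage13Params P) j)
    (hε3 : ∀ P : B12.RunParams, Step.InInterval γ P.K (gOfRecord₁₃ F N θ.toStage13Params P) → ∀ j, 1 ≤ j → j ≤ P.K →
      (143 * (((((F.P P.K).d + 4 : ℕ) : ℝ)) ^ 2 / 4) ^ 2) * epsOfRecord θ.ν (gOfRecord₁₃ F N θ.toStage13Params P) j ≤ 1 / 3)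
    (hε2 : ∀ P : B12.RunParams, Step.InInterval γ P.K (gOfRecord₁₃ F N θ.toStage13Params P) → ∀ j, 1 ≤ j → j ≤ P.K →
      2 * epsOfRecord θ.ν (gOfRecord₁₃ F N θ.toStage13Params P) j ≤ 2 * ExpMeanLog.deltaSU (Fin N) / ((((F.P P.K).d + 4) * (F.P P.K).L : ℕ) : ℝ) ^ 2)
    (hsolv : ∀ P : B12.RunParams, Step.InInterval γ P.K (gOfRecord₁₃ F N θ.toStage13Params P) → ∀ j, 1 ≤ j → j ≤ P.K →
      ∀ (s : SeqOfRecord F θ.ν θ.τ9.M (gOfRecord₁₃ F N θ.toStage13Params P) P.K j) (V : GaugeField (F.P P.K) j (SU N)),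
      chiSeqOfRecord F N θ.ν θ.τ9.M (gOfRecord₁₃ F N θ.toStage13Params P) P.K j s V ≠ 0 →
      ∀ a ∈ cubesIn (fun a : ↥(cubeIndices (F.P P.K) (cubeSide (F.P P.K).L θ.ν.M₂ (RkOfRecord (F.P P.K).L θ.ν.r (gOfRecord₁₃ F N θ.toStage13Params P j)) j)) =>
          cubeEnl (F.P P.K) (cubeSide (F.P P.K).L θ.ν.M₂ (RkOfRecord (F.P P.K).L θ.ν.r (gOfRecord₁₃ F N θ.toStage13Params P j)) j) a 0) (s.Ω j),
        ∃ U₀, IsMinimizer (avOfRecord F N P.K) {U | PlaqSmall (θ.ν.εreg * (F.P P.K).eta j ^ 2) U}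
          (Bj θ.ν.M₁ (cubeEnl (F.P P.K) (cubeSide (F.P P.K).L θ.ν.M₂ (RkOfRecord (F.P P.K).L θ.ν.r (gOfRecord₁₃ F N θ.toStage13Params P j)) j) a 4) j)
          (avgFamily (avOfRecord F N P.K) (qsstarGIter0 j V)) U₀)
    (hcov : ∀ P : B12.RunParams, Step.InInterval γ P.K (gOfRecord₁₃ F N θ.toStage13Params P) → ∀ j, 1 ≤ j → j ≤ P.K →
      ∀ s : SeqOfRecord F θ.ν θ.τ9.M (gOfRecord₁₃ F N θ.toStage13Params P) P.K j,
      s.Ω j ⊆ ⋃ a ∈ cubesIn (fun a : ↥(cubeIndices (F.P P.K) (cubeSide (F.P P.K).L θ.ν.M₂ (RkOfRecord (F.P P.K).L θ.ν.r (gOfRecord₁₃ F N θ.toStage13Params P j)) j)) =>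
          cubeEnl (F.P P.K) (cubeSide (F.P P.K).L θ.ν.M₂ (RkOfRecord (F.P P.K).L θ.ν.r (gOfRecord₁₃ F N θ.toStage13Params P j)) j) a 0) (s.Ω j),
        cubeEnl (F.P P.K) (cubeSide (F.P P.K).L θ.ν.M₂ (RkOfRecord (F.P P.K).L θ.ν.r (gOfRecord₁₃ F N θ.toStage13Params P j)) j) a 0)
    (σ : (P : B12.RunParams) → Sect3Supplier θ P) (hσ : ∀ P : B12.RunParams, Step.InInterval γ P.K (gOfRecord₁₃ F N θ.toStage13Params P) → SupplierObligations θ P (σ P))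
    (hσB : ∀ P : B12.RunParams, Step.InInterval γ P.K (gOfRecord₁₃ F N θ.toStage13Params P) → SupplierBorel θ P (σ P)) :
    B16.Thm1Printed (datumOfRecord₁₃CoPH F N θ h.toCore).C :=
  thm1Printed_datumOfRecord₁₃CoPH_of_obligations h.toCore hsel hθ hκ hE₀ hB₀ hθ.toStage9.2.2.2 (lt_min hγ hθ.toStage9.gamma_pos) σ
    (fun P hP => hσ P (step_inInterval_top_of_flow_inInterval_min θ h.toCore hP).1) fun P hP =>
    have hW := step_inInterval_top_of_flow_inInterval_min θ h.toCore hP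
    noExpansionObligation_of_gaussCert_of_supplierBorel_of_solvable θ P hζ hq h hθ hM₁ hle hcR hW.2 (hPC P hW.1) (h3 P hW.1) (hR P hW.1)
      (hε P hW.1) (hε3 P hW.1) (hε2 P hW.1) (hsolv P hW.1) (hcov P hW.1) (σ P) (hσB P hW.1)

/-- **★★★★ THE K1⁷-KEYED EDITION: N11's PRINTED OUTPUT AT `datumOfRecord₁₃SepCoPH F N θ h` OF A GAUSSIAN-CLASS `θ`** (K1⁷'s `∃`-body reads `(h : θ.Provisos₁₃SepCoPH F 2)` and
this datum; `= datumOfRecord₁₃CoPH … h.toCore` by def-T's `datumOfRecord₁₃SepCoPH_eq_coPH`, `rfl`).  Same displayed rows; nothing else.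
[cite: Balaban1988Convergent, Thm 1 p.262, Theorem p.245, §3 p.279, (0.2) p.244; Balaban1989LargeFieldII, Thm 1 p.355; Balaban1989LargeFieldI, (0.3)–(0.4) p.176] -/
theorem thm1Printed_datumOfRecord₁₃SepCoPH_of_gaussCert_of_supplierBorel_of_solvable
    (hζ : ∀ (p : B12.RunParams) (n : ℕ) (Ω Λ : ℕ → Set (Site (F.P p.K) 0)), (θ.Zh p n Ω Λ).ζ0 = (ZhPinOfRecord₁₃ θ.toStage13Params p Ω Λ).ζ0)
    (hq : ∀ (p : B12.RunParams) (n : ℕ) (Ω Λ : ℕ → Set (Site (F.P p.K) 0)) (j : ℕ) (Λ' : Set (Site (F.P p.K) 0)) (ω : MultiCfg (F.P p.K) (SU N) (FluctV N)),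
      (θ.Zh p n Ω Λ).quad j Λ' ω = ∑ b ∈ (Set.toFinite (bondsIn j (Λ'ᶜ ∩ Ω (j + 1)))).toFinset, ‖(ω j).2 b‖ ^ 2)
    (h : θ.Provisos₁₃SepCoPH F N) (hsel : θ.ppSel = ppSelLiveOfRecord F N θ.ν θ.τ9 (EOfRecord₁₃ F N θ.toStage13Params) (wOfRecord₉ F N θ.toStage9Params))
    (hθ : θ.Admissible F N) (hκ : 0 ≤ θ.s2.lf.κ) (hE₀ : 0 ≤ θ.s2.lf.E₀) (hB₀ : 0 ≤ θ.s2.lf.B₀)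
    (hM₁ : 0 < θ.ν.M₁) (hle : θ.ν.M₁ ≤ θ.τ9.M) (hcR : 2 ≤ θ.s2.cR) {γ : ℝ} (hγ : 0 < γ)
    (hPC : ∀ P : B12.RunParams, Step.InInterval γ P.K (gOfRecord₁₃ F N θ.toStage13Params P) → PartCompat₁₃ F N θ.toStage13Params P P.K)
    (h3 : ∀ P : B12.RunParams, Step.InInterval γ P.K (gOfRecord₁₃ F N θ.toStage13Params P) → ∀ j, 1 ≤ j → j ≤ P.K →
      3 * side (F.P P.K).L θ.ν.M₁ j ≤ cubeSide (F.P P.K).L θ.ν.M₂ (RkOfRecord (F.P P.K).L θ.ν.r (gOfRecord₁₃ F N θ.toStage13Params P j)) j)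
    (hR : ∀ P : B12.RunParams, Step.InInterval γ P.K (gOfRecord₁₃ F N θ.toStage13Params P) → ∀ j, 1 ≤ j → j ≤ P.K →
      (F.P P.K).L ^ j + (((F.P P.K).d + 4) * (F.P P.K).L + 2) * (∑ l ∈ Finset.range j, (F.P P.K).L ^ l) + 2 ≤
        cubeSide (F.P P.K).L θ.ν.M₂ (RkOfRecord (F.P P.K).L θ.ν.r (gOfRecord₁₃ F N θ.toStage13Params P j)) j)
    (hε : ∀ P : B12.RunParams, Step.InInterval γ P.K (gOfRecord₁₃ F N θ.toStage13Params P) → ∀ j, 1 ≤ j → j ≤ P.K →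
      0 < epsOfRecord θ.ν (gOfRecord₁₃ F N θ.toStage13Params P) j)
    (hε3 : ∀ P : B12.RunParams, Step.InInterval γ P.K (gOfRecord₁₃ F N θ.toStage13Params P) → ∀ j, 1 ≤ j → j ≤ P.K →
      (143 * (((((F.P P.K).d + 4 : ℕ) : ℝ)) ^ 2 / 4) ^ 2) * epsOfRecord θ.ν (gOfRecord₁₃ F N θ.toStage13Params P) j ≤ 1 / 3)
    (hε2 : ∀ P : B12.RunParams, Step.InInterval γ P.K (gOfRecord₁₃ F N θ.toStage13Params P) → ∀ j, 1 ≤ j → j ≤ P.K →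
      2 * epsOfRecord θ.ν (gOfRecord₁₃ F N θ.toStage13Params P) j ≤ 2 * ExpMeanLog.deltaSU (Fin N) / ((((F.P P.K).d + 4) * (F.P P.K).L : ℕ) : ℝ) ^ 2)
    (hsolv : ∀ P : B12.RunParams, Step.InInterval γ P.K (gOfRecord₁₃ F N θ.toStage13Params P) → ∀ j, 1 ≤ j → j ≤ P.K →
      ∀ (s : SeqOfRecord F θ.ν θ.τ9.M (gOfRecord₁₃ F N θ.toStage13Params P) P.K j) (V : GaugeField (F.P P.K) j (SU N)),
      chiSeqOfRecord F N θ.ν θ.τ9.M (gOfRecord₁₃ F N θ.toStage13Params P) P.K j s V ≠ 0 →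
      ∀ a ∈ cubesIn (fun a : ↥(cubeIndices (F.P P.K) (cubeSide (F.P P.K).L θ.ν.M₂ (RkOfRecord (F.P P.K).L θ.ν.r (gOfRecord₁₃ F N θ.toStage13Params P j)) j)) =>
          cubeEnl (F.P P.K) (cubeSide (F.P P.K).L θ.ν.M₂ (RkOfRecord (F.P P.K).L θ.ν.r (gOfRecord₁₃ F N θ.toStage13Params P j)) j) a 0) (s.Ω j),
        ∃ U₀, IsMinimizer (avOfRecord F N P.K) {U | PlaqSmall (θ.ν.εreg * (F.P P.K).eta j ^ 2) U}
          (Bj θ.ν.M₁ (cubeEnl (F.P P.K) (cubeSide (F.P P.K).L θ.ν.M₂ (RkOfRecord (F.P P.K).L θ.ν.r (gOfRecord₁₃ F N θ.toStage13Params P j)) j) a 4) j)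
          (avgFamily (avOfRecord F N P.K) (qsstarGIter0 j V)) U₀)
    (hcov : ∀ P : B12.RunParams, Step.InInterval γ P.K (gOfRecord₁₃ F N θ.toStage13Params P) → ∀ j, 1 ≤ j → j ≤ P.K →
      ∀ s : SeqOfRecord F θ.ν θ.τ9.M (gOfRecord₁₃ F N θ.toStage13Params P) P.K j,
      s.Ω j ⊆ ⋃ a ∈ cubesIn (fun a : ↥(cubeIndices (F.P P.K) (cubeSide (F.P P.K).L θ.ν.M₂ (RkOfRecord (F.P P.K).L θ.ν.r (gOfRecord₁₃ F N θ.toStage13Params P j)) j)) =>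
          cubeEnl (F.P P.K) (cubeSide (F.P P.K).L θ.ν.M₂ (RkOfRecord (F.P P.K).L θ.ν.r (gOfRecord₁₃ F N θ.toStage13Params P j)) j) a 0) (s.Ω j),
        cubeEnl (F.P P.K) (cubeSide (F.P P.K).L θ.ν.M₂ (RkOfRecord (F.P P.K).L θ.ν.r (gOfRecord₁₃ F N θ.toStage13Params P j)) j) a 0)
    (σ : (P : B12.RunParams) → Sect3Supplier θ P) (hσ : ∀ P : B12.RunParams, Step.InInterval γ P.K (gOfRecord₁₃ F N θ.toStage13Params P) → SupplierObligations θ P (σ P))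
    (hσB : ∀ P : B12.RunParams, Step.InInterval γ P.K (gOfRecord₁₃ F N θ.toStage13Params P) → SupplierBorel θ P (σ P)) :
    B16.Thm1Printed (datumOfRecord₁₃SepCoPH F N θ h).C :=
  thm1Printed_datumOfRecord₁₃CoPH_of_gaussCert_of_supplierBorel_of_solvable θ hζ hq h hsel hθ hκ hE₀ hB₀ hM₁ hle hcR hγ hPC h3 hR hε hε3 hε2 hsolv hcov σ hσ hσB

/-- **★★★★★ N11's PRINTED OUTPUT AT THE K1⁷-KEYED DATUM OF THE NAMED GAUSSIAN CERTIFICATE `gaussPinH θ` — THE HONEST STATE OF N11 ON THE `SupplierBorel` ROAD, NO READING-LINE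
PRIMITIVE, NO CLASS HYPOTHESIS.**  Displayed EXACTLY: the key `h : θ.Provisos₁₃SepCoPH` (transferred by `provisos₁₃SepCoPH_gaussPinH`), the live-selector line of `θ` (selector
clause, admissibility, the three signs), the letters `0 < M₁ ≤ M`, `2 ≤ cR`; SOME `γ > 0`; and PER RUN IN THE WINDOW `]0, γ]`: `PartCompat₁₃` up to `K`, K0's per-cube
[15]-solvability inside `χ_j` + cube cover + numerics at levels `1…K`, and [III] §3's supplier AT THE CERTIFICATE with `SupplierObligations` + `SupplierBorel`.
[cite: Balaban1988Convergent, Thm 1 p.262, Theorem p.245, §3 p.279, (0.2) p.244, (3.24)–(3.25) p.270; Balaban1989LargeFieldII, Thm 1 p.355; Balaban1989LargeFieldI, (0.3)–(0.4) p.176, p.177 (i)–(ii); Balaban1985Variational, Thm 1 (7)–(8) pp.278–279] -/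
theorem thm1Printed_datumOfRecord₁₃SepCoPH_gaussPinH_of_supplierBorel_of_solvable
    (h : θ.Provisos₁₃SepCoPH F N) (hsel : θ.ppSel = ppSelLiveOfRecord F N θ.ν θ.τ9 (EOfRecord₁₃ F N θ.toStage13Params) (wOfRecord₉ F N θ.toStage9Params))
    (hθ : θ.Admissible F N) (hκ : 0 ≤ θ.s2.lf.κ) (hE₀ : 0 ≤ θ.s2.lf.E₀) (hB₀ : 0 ≤ θ.s2.lf.B₀)
    (hM₁ : 0 < θ.ν.M₁) (hle : θ.ν.M₁ ≤ θ.τ9.M) (hcR : 2 ≤ θ.s2.cR) {γ : ℝ} (hγ : 0 < γ)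
    (hPC : ∀ P : B12.RunParams, Step.InInterval γ P.K (gOfRecord₁₃ F N θ.toStage13Params P) → PartCompat₁₃ F N θ.toStage13Params P P.K)
    (h3 : ∀ P : B12.RunParams, Step.InInterval γ P.K (gOfRecord₁₃ F N θ.toStage13Params P) → ∀ j, 1 ≤ j → j ≤ P.K →
      3 * side (F.P P.K).L θ.toStage13Params.ν.M₁ j ≤ cubeSide (F.P P.K).L θ.toStage13Params.ν.M₂ (RkOfRecord (F.P P.K).L θ.toStage13Params.ν.r (gOfRecord₁₃ F N θ.toStage13Params P j)) j)
    (hR : ∀ P : B12.RunParams, Step.InInterval γ P.K (gOfRecord₁₃ F N θ.toStage13Params P) → ∀ j, 1 ≤ j → j ≤ P.K →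
      (F.P P.K).L ^ j + (((F.P P.K).d + 4) * (F.P P.K).L + 2) * (∑ l ∈ Finset.range j, (F.P P.K).L ^ l) + 2 ≤
        cubeSide (F.P P.K).L θ.toStage13Params.ν.M₂ (RkOfRecord (F.P P.K).L θ.toStage13Params.ν.r (gOfRecord₁₃ F N θ.toStage13Params P j)) j)
    (hε : ∀ P : B12.RunParams, Step.InInterval γ P.K (gOfRecord₁₃ F N θ.toStage13Params P) → ∀ j, 1 ≤ j → j ≤ P.K →
      0 < epsOfRecord θ.toStage13Params.ν (gOfRecord₁₃ F N θ.toStage13Params P) j)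
    (hε3 : ∀ P : B12.RunParams, Step.InInterval γ P.K (gOfRecord₁₃ F N θ.toStage13Params P) → ∀ j, 1 ≤ j → j ≤ P.K →
      (143 * (((((F.P P.K).d + 4 : ℕ) : ℝ)) ^ 2 / 4) ^ 2) * epsOfRecord θ.toStage13Params.ν (gOfRecord₁₃ F N θ.toStage13Params P) j ≤ 1 / 3)
    (hε2 : ∀ P : B12.RunParams, Step.InInterval γ P.K (gOfRecord₁₃ F N θ.toStage13Params P) → ∀ j, 1 ≤ j → j ≤ P.K →
      2 * epsOfRecord θ.toStage13Params.ν (gOfRecord₁₃ F N θ.toStage13Params P) j ≤ 2 * ExpMeanLog.deltaSU (Fin N) / ((((F.P P.K).d + 4) * (F.P P.K).L : ℕ) : ℝ) ^ 2)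
    (hsolv : ∀ P : B12.RunParams, Step.InInterval γ P.K (gOfRecord₁₃ F N θ.toStage13Params P) → ∀ j, 1 ≤ j → j ≤ P.K →
      ∀ (s : SeqOfRecord F θ.toStage13Params.ν θ.toStage13Params.τ9.M (gOfRecord₁₃ F N θ.toStage13Params P) P.K j) (V : GaugeField (F.P P.K) j (SU N)),
      chiSeqOfRecord F N θ.toStage13Params.ν θ.toStage13Params.τ9.M (gOfRecord₁₃ F N θ.toStage13Params P) P.K j s V ≠ 0 →
      ∀ a ∈ cubesIn (fun a : ↥(cubeIndices (F.P P.K) (cubeSide (F.P P.K).L θ.toStage13Params.ν.M₂ (RkOfRecord (F.P P.K).L θ.toStage13Params.ν.r (gOfRecord₁₃ F N θ.toStage13Params P j)) j)) =>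
          cubeEnl (F.P P.K) (cubeSide (F.P P.K).L θ.toStage13Params.ν.M₂ (RkOfRecord (F.P P.K).L θ.toStage13Params.ν.r (gOfRecord₁₃ F N θ.toStage13Params P j)) j) a 0) (s.Ω j),
        ∃ U₀, IsMinimizer (avOfRecord F N P.K) {U | PlaqSmall (θ.toStage13Params.ν.εreg * (F.P P.K).eta j ^ 2) U}
          (Bj θ.toStage13Params.ν.M₁ (cubeEnl (F.P P.K) (cubeSide (F.P P.K).L θ.toStage13Params.ν.M₂ (RkOfRecord (F.P P.K).L θ.toStage13Params.ν.r (gOfRecord₁₃ F N θ.toStage13Params P j)) j) a 4) j)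
          (avgFamily (avOfRecord F N P.K) (qsstarGIter0 j V)) U₀)
    (hcov : ∀ P : B12.RunParams, Step.InInterval γ P.K (gOfRecord₁₃ F N θ.toStage13Params P) → ∀ j, 1 ≤ j → j ≤ P.K →
      ∀ s : SeqOfRecord F θ.toStage13Params.ν θ.toStage13Params.τ9.M (gOfRecord₁₃ F N θ.toStage13Params P) P.K j,
      s.Ω j ⊆ ⋃ a ∈ cubesIn (fun a : ↥(cubeIndices (F.P P.K) (cubeSide (F.P P.K).L θ.toStage13Params.ν.M₂ (RkOfRecord (F.P P.K).L θ.toStage13Params.ν.r (gOfRecord₁₃ F N θ.toStage13Params P j)) j)) =>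
          cubeEnl (F.P P.K) (cubeSide (F.P P.K).L θ.toStage13Params.ν.M₂ (RkOfRecord (F.P P.K).L θ.toStage13Params.ν.r (gOfRecord₁₃ F N θ.toStage13Params P j)) j) a 0) (s.Ω j),
        cubeEnl (F.P P.K) (cubeSide (F.P P.K).L θ.toStage13Params.ν.M₂ (RkOfRecord (F.P P.K).L θ.toStage13Params.ν.r (gOfRecord₁₃ F N θ.toStage13Params P j)) j) a 0)
    (σ : (P : B12.RunParams) → Sect3Supplier (gaussPinH θ) P)
    (hσ : ∀ P : B12.RunParams, Step.InInterval γ P.K (gOfRecord₁₃ F N θ.toStage13Params P) → SupplierObligations (gaussPinH θ) P (σ P))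
    (hσB : ∀ P : B12.RunParams, Step.InInterval γ P.K (gOfRecord₁₃ F N θ.toStage13Params P) → SupplierBorel (gaussPinH θ) P (σ P)) :
    B16.Thm1Printed (datumOfRecord₁₃SepCoPH F N (gaussPinH θ) (provisos₁₃SepCoPH_gaussPinH h)).C :=
  thm1Printed_datumOfRecord₁₃SepCoPH_of_gaussCert_of_supplierBorel_of_solvable (gaussPinH θ) (gaussPinH_ζ0 θ) (gaussPinH_quad θ) (provisos₁₃SepCoPH_gaussPinH h) hsel
    hθ hκ hE₀ hB₀ hM₁ hle hcR hγ hPC h3 hR hε hε3 hε2 hsolv hcov σ hσ hσB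

end Printed

end Summit.QuantumFields.YangMills.Theorems.BalabanUVNodesN11Sect3SupplyChainBorelBThm1PrintedOfSolvable

end
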